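import Literature.NumberTheory.LFunctions.CertifiedArtinHolomorphyCriterion
import HarnessLib

/-!
# Booker's remark "any monomial group is almost monomial" — proved

Topic `Literature/NumberTheory/LFunctions`; companion (theorems only, no new definition, no named
fact) of `CertifiedArtinHolomorphyCriterion.lean`. A. R. Booker, *Artin's conjecture, Turing's
method, and the Riemann hypothesis*, Experiment. Math. 15 (2006), §2 p. 389, after Definition 2.1:
"From the figure it is easy to see that any monomial group is almost monomial." We prove it for the
typed notions (`Booker2006.IsAlmostMonomial`, `Booker2006.IsDMPositive`, the tree's `IsMGroup`), which
also certifies that the typed Definition 2.1 is inhabited non-trivially (every M-group, e.g. every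
finite nilpotent group, qualifies).

Proof (the figure's content): in an M-group every irreducible character `ψ` is itself a monomial
`σ = Ind_H^G λ`, so a DM-positive virtual character `χ` has `⟨χ, ψ⟩ ∈ ℤ_{≥ 0}` for every irreducible
`ψ`; if `Tr ρ = χ₁ + χ₂` then `⟨χ₁, ψ⟩ + ⟨χ₂, ψ⟩ = δ_{ρψ}` (orthonormality,
`IsIrrChar.classInner_eq`), forcing all Fourier coefficients of one `χᵢ` to vanish, whence `χᵢ = 0`
by completeness (`IsClassFun.eq_zero_of_forall_classInner_eq_zero`).

Also proved (appended): Booker's remark that condition **(2–6)** (p. 391; `IsRHCheckable`: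
"`Tr ρ ≠ χ₁ + 2χ₂` for virtual characters `χᵢ ≠ 0` with `⟨χᵢ, σ⟩ ≥ 0` for all monomial `σ`")
"is a weaker condition than almost monomiality": `isRHCheckable_of_isAlmostMonomial`
(`IsAlmostMonomial G → IsRHCheckable G`; apply Definition 2.1 to `Tr ρ = (χ₁ + χ₂) + χ₂`, the
case `χ₁ + χ₂ = 0` being excluded because `−Tr ρ` is not DM-positive:
`⟨−Tr ρ, Ind_1^G 1⟩ = −dim ρ < 0`, `not_isDMPositive_neg_of_isIrrChar`), with the small API
`IsDMPositive.add`, `IsDMPositive.apply_one_nonneg`, and `isRHCheckable_of_isMGroup`.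

## References

* [Booker2006] A. R. Booker, Experiment. Math. 15 (2006) 385–407, §2 Definition 2.1 and the remark
  following it, p. 389; condition (2–6) and the sentence following it, p. 391 (arXiv:math/0507502,
  p. 9: "which is a weaker condition than almost monomiality").
-/

noncomputable section

open scoped ComplexOrder

namespace Literature.NumberTheory.LFunctions

namespace Booker2006

open Literature.RepresentationTheory.FiniteGroups

variable {G : Type} [Group G] [Fintype G]

/-- In an M-group a DM-positive virtual character has a non-negative INTEGER inner product with every
irreducible character (each irreducible character is a monomial `Ind_H^G λ`).
[cite: Booker2006, §2 p. 389 (remark after Definition 2.1)] -/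
theorem IsDMPositive.exists_nat_classInner_eq (hG : IsMGroup G) {χ : G → ℂ} (hχ : χ ∈ virtChars G)
    (hpos : IsDMPositive χ) {ψ : G → ℂ} (hψ : IsIrrChar G ψ) :
    ∃ n : ℕ, classInner χ ψ = n := by
  obtain ⟨H, θ, hψeq⟩ := hG.exists_eq_indClassFun ψ hψ
  obtain ⟨m, hm⟩ := exists_int_classInner_of_mem_virtChars hχ hψ
  have h0 : (0 : ℂ) ≤ classInner χ ψ := by rw [hψeq]; exact hpos H θ
  rw [hm] at h0
  have hm0 : (0 : ℤ) ≤ m := by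
    have h0' : ((0 : ℝ) : ℂ) ≤ ((m : ℝ) : ℂ) := by
      simpa [Complex.ofReal_intCast] using h0
    exact_mod_cast (Complex.real_le_real.1 h0')
  obtain ⟨n, rfl⟩ := Int.eq_ofNat_of_zero_le hm0
  exact ⟨n, by simpa using hm⟩

/-- The decomposition step: if `Tr ρ = χ + χ'` with `χ, χ'` DM-positive virtual characters of an
M-group and `⟨χ, Tr ρ⟩ = 0`, then `χ = 0`. [cite: Booker2006, §2 p. 389 (remark after Definition 2.1)] -/
theorem eq_zero_of_classInner_self_eq_zero (hG : IsMGroup G) {ρ χ χ' : G → ℂ} (hρ : IsIrrChar G ρ)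
    (hχ : χ ∈ virtChars G) (hχ' : χ' ∈ virtChars G) (hpos : IsDMPositive χ) (hpos' : IsDMPositive χ')
    (hsum : ρ = χ + χ') (h0 : classInner χ ρ = 0) : χ = 0 := by
  classical
  refine (isClassFun_of_mem_virtChars hχ).eq_zero_of_forall_classInner_eq_zero fun ψ hψ => ?_
  by_cases hρψ : ρ = ψ
  · subst hρψ; exact h0
  · obtain ⟨n, hn⟩ := hpos.exists_nat_classInner_eq hG hχ hψ
    obtain ⟨n', hn'⟩ := hpos'.exists_nat_classInner_eq hG hχ' hψ
    have hadd : classInner χ ψ + classInner χ' ψ = 0 := by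
      rw [← classInner_add_left, ← hsum, IsIrrChar.classInner_eq hρ hψ, if_neg hρψ]
    rw [hn, hn'] at hadd
    have hnn : n + n' = 0 := by exact_mod_cast hadd
    rw [hn]
    simp [Nat.eq_zero_of_add_eq_zero_right hnn]

/-- **Booker 2006, §2 p. 389: "any monomial group is almost monomial"** — for the typed Definition 2.1
and the tree's `IsMGroup`. [cite: Booker2006, §2 p. 389 (remark after Definition 2.1)] -/
theorem isAlmostMonomial_of_isMGroup (hG : IsMGroup G) : IsAlmostMonomial G := by
  classical
  intro ρ hρ χ₁ hχ₁ χ₂ hχ₂ hpos₁ hpos₂ hsum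
  have hρ' : IsIrrChar G ρ := hρ
  obtain ⟨n₁, hn₁⟩ := hpos₁.exists_nat_classInner_eq hG hχ₁ hρ'
  obtain ⟨n₂, hn₂⟩ := hpos₂.exists_nat_classInner_eq hG hχ₂ hρ'
  have hadd : classInner χ₁ ρ + classInner χ₂ ρ = 1 := by
    rw [← classInner_add_left, ← hsum, IsIrrChar.classInner_eq hρ' hρ', if_pos rfl]
  rw [hn₁, hn₂] at hadd
  have h12 : n₁ + n₂ = 1 := by exact_mod_cast hadd
  rcases Nat.eq_zero_or_pos n₁ with h1 | h1
  · left
    refine eq_zero_of_classInner_self_eq_zero hG hρ' hχ₁ hχ₂ hpos₁ hpos₂ hsum ?_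
    rw [hn₁, h1, Nat.cast_zero]
  · right
    have h2 : n₂ = 0 := by omega
    refine eq_zero_of_classInner_self_eq_zero hG hρ' hχ₂ hχ₁ hpos₂ hpos₁ (hsum.trans (add_comm _ _)) ?_
    rw [hn₂, h2, Nat.cast_zero]

/-- Instance form: an M-group (as a type-class hypothesis) is almost monomial.
[cite: Booker2006, §2 p. 389 (remark after Definition 2.1)] -/
theorem isAlmostMonomial_of_mGroup [hG : IsMGroup G] : IsAlmostMonomial G :=
  isAlmostMonomial_of_isMGroup hG

/-! ### (2–6) is weaker than almost monomiality (Booker p. 391) -/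

omit [Fintype G] in
/-- The scalar product over the trivial subgroup: `⟨φ|_1, ψ⟩_1 = φ(1) ψ(1)`. [folklore] -/
private theorem classInner_restrict_bot (φ : G → ℂ) (ψ : (⊥ : Subgroup G) → ℂ) :
    classInner (fun x : (⊥ : Subgroup G) => φ x) ψ = φ 1 * ψ 1 := by
  rw [classInner_apply, Fintype.card_unique, Fintype.sum_unique]
  have hd : (default : (⊥ : Subgroup G)) = 1 := Subsingleton.elim _ _
  rw [hd, inv_one]
  simp

/-- `⟨χ, Ind_1^G 1⟩ = χ(1)` for a class function `χ`: the regular character `Ind_1^G 1` is monomial,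
so DM-positivity tests in particular the sign of `χ(1)` (Frobenius reciprocity
`classInner_indClassFun_right`). [folklore] -/
private theorem classInner_indClassFun_bot_one {χ : G → ℂ} (hχ : IsClassFun χ) :
    classInner χ (indClassFun (⊥ : Subgroup G) fun h => ((1 : (⊥ : Subgroup G) →* ℂˣ) h : ℂ)) =
      χ 1 := by
  rw [classInner_indClassFun_right ⊥ _ hχ, classInner_restrict_bot]
  simp

/-- A DM-positive class function has `0 ≤ χ(1)` (test against the regular character).
[cite: Booker2006, §2 (2–4) p. 389] -/
theorem IsDMPositive.apply_one_nonneg {χ : G → ℂ} (hχ : IsClassFun χ) (hpos : IsDMPositive χ) :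
    0 ≤ χ 1 := by
  have h := hpos ⊥ 1
  rwa [classInner_indClassFun_bot_one hχ] at h

/-- The sum of two DM-positive functions is DM-positive. [cite: Booker2006, §2 (2–4) p. 389] -/
theorem IsDMPositive.add {χ χ' : G → ℂ} (h : IsDMPositive χ) (h' : IsDMPositive χ') :
    IsDMPositive (χ + χ') := fun H θ => by
  rw [classInner_add_left]
  exact add_nonneg (h H θ) (h' H θ)

omit [Fintype G] in
/-- Character degrees are positive (an irreducible representation is non-zero: Mathlib's
`Representation.IsIrreducible` is `IsSimpleOrder` on subrepresentations). [folklore] -/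
private theorem pos_of_mem_charDegrees_aux {d : ℕ} (hd : d ∈ charDegrees G) : 0 < d := by
  obtain ⟨V, _, _, _, ρ, hρ, rfl⟩ := hd
  haveI : Nontrivial (Subrepresentation ρ) := hρ.toNontrivial
  have hne : (⊥ : Subrepresentation ρ) ≠ ⊤ := bot_ne_top
  haveI : Nontrivial V := by
    by_contra htriv
    rw [not_nontrivial_iff_subsingleton] at htriv
    exact hne (Subrepresentation.toSubmodule_injective (Subsingleton.elim _ _))
  exact Module.finrank_pos

/-- The negative of an irreducible character is not DM-positive (`⟨−Tr ρ, Ind_1^G 1⟩ = −dim ρ < 0`).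
[cite: Booker2006, §2 (2–4) p. 389] -/
theorem not_isDMPositive_neg_of_isIrrChar {ρ : G → ℂ} (hρ : IsIrrChar G ρ) : ¬ IsDMPositive (-ρ) := by
  intro hpos
  have hcl : IsClassFun (-ρ) := fun s t => by
    rw [Pi.neg_apply, Pi.neg_apply, hρ.isCharacter.isClassFun s t]
  have h0 := hpos.apply_one_nonneg hcl
  obtain ⟨d, hd, hd1⟩ := hρ.exists_apply_one
  have hdpos : 0 < d := pos_of_mem_charDegrees_aux hd
  rw [Pi.neg_apply, hd1] at h0
  have h0' : ((d : ℝ) : ℂ) ≤ ((0 : ℝ) : ℂ) := by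
    simpa using (neg_nonneg.mp (by simpa using h0) : (d : ℂ) ≤ 0)
  have : (d : ℝ) ≤ 0 := Complex.real_le_real.1 h0'
  exact absurd this (not_le.mpr (by exact_mod_cast hdpos))

/-- **Booker 2006, §2 (2–6), p. 391: condition (2–6) "is a weaker condition than almost
monomiality"** — for the typed notions: an almost monomial group (Definition 2.1,
`IsAlmostMonomial`) satisfies (2–6) (`IsRHCheckable`). Proof: if `Tr ρ = χ₁ + 2χ₂` with `χᵢ`
DM-positive virtual characters, apply Definition 2.1 to `Tr ρ = (χ₁ + χ₂) + χ₂`; either `χ₂ = 0`,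
or `χ₁ + χ₂ = 0`, in which case `χ₂ = Tr ρ` and `χ₁ = −Tr ρ` is not DM-positive
(`⟨−Tr ρ, Ind_1^G 1⟩ = −dim ρ < 0`), a contradiction.
[cite: Booker2006, §2 (2–6) p. 391] -/
theorem isRHCheckable_of_isAlmostMonomial (hG : IsAlmostMonomial G) : IsRHCheckable G := by
  intro ρ hρ χ₁ hχ₁ χ₂ hχ₂ hpos₁ hpos₂ hsum
  have hρ' : IsIrrChar G ρ := hρ
  have hsum' : ρ = (χ₁ + χ₂) + χ₂ := by rw [hsum, two_nsmul, add_assoc]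
  rcases hG ρ hρ _ (add_mem hχ₁ hχ₂) χ₂ hχ₂ (hpos₁.add hpos₂) hpos₂ hsum' with h0 | h0
  · exfalso
    have hχ₂ρ : χ₂ = ρ := by rw [hsum', h0, zero_add]
    have hχ₁eq : χ₁ = -ρ := by
      rw [hχ₂ρ] at h0
      exact eq_neg_of_add_eq_zero_left h0
    exact not_isDMPositive_neg_of_isIrrChar hρ' (hχ₁eq ▸ hpos₁)
  · exact Or.inr h0

/-- In particular every M-group satisfies (2–6). [cite: Booker2006, §2 (2–6) p. 391] -/
theorem isRHCheckable_of_isMGroup (hG : IsMGroup G) : IsRHCheckable G :=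
  isRHCheckable_of_isAlmostMonomial (isAlmostMonomial_of_isMGroup hG)

end Booker2006

end Literature.NumberTheory.LFunctions

end
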